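import Literature.NumberTheory.Automorphic.AutomorphicRepsGLCuspFormsSquareIntegrable
import Literature.NumberTheory.Automorphic.AutomorphicRepsGLCuspidalL2Step3
import HarnessLib

/-!
# Realisation of irreducible spaces of cusp forms on `GL_n` in `L²_cusp`: decomposition of
# `AutomorphicRepsGL.exists_le_formsOfL2_of_W'_eq_bot` along Harish-Chandra's closure theorem

Topic `NumberTheory/Automorphic`; sibling proof file of `AutomorphicRepsGLIrreducibleL2`, which
records as ONE named fact (D-0014)

* `AutomorphicRepsGL.exists_le_formsOfL2_of_W'_eq_bot hcpt μ`: an irreducible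
  `(𝔤, K_∞) × GL_n(𝔸_K^∞)`-stable space `W` of `A_G`-invariant cusp forms on `GL_n(𝔸_K)` (a
  cuspidal automorphic representation datum `W / ⊥` in the sense of Borel–Jacquet) is contained
  in `V_Π = formsOfL2 hcpt μ Π` for some irreducible closed invariant subspace `Π` of
  `L²_cusp(GL_n(𝔸_K) ⧸ A_G GL_n(K), μ)`.

Its proof in print (Borel–Jacquet 1979, 4.4–4.6; Getz–Hahn 2024, Thm. 6.5.1 with its proof on
p. 192 and Thm. 6.5.2; Harish-Chandra 1953, §7 and Thm. 5) has three analytic inputs of a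
different nature, none of which is in Mathlib or `Literature` (triage **XL**): (a) `A_G`-invariant
cusp forms are bounded, hence square integrable on the finite-volume quotient; (b) the closure in
`L²` of a `𝔤`-stable space of well-behaved (analytic) vectors is `G`-invariant; (c) for an
irreducible admissible such space the closure has no closed invariant subspaces besides `0` and
itself. (a) is already the named fact `AutomorphicRepsGL.cuspidal_bounded hcpt` of
`AutomorphicRepsGLCuspFormsSquareIntegrable` (Getz–Hahn Thm. 9.8.1), with the passage "bounded ⇒
square integrable with class in `L²_cusp`" proved there
(`AutomorphicRepsGL.exists_toLp_mem_cuspidalSubspace_of_bounded`). This file vendors (b) and (c)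
as two named facts, each a separately printed theorem of Harish-Chandra, and PROVES the assembly:

1. `AutomorphicRepsGL.cuspidal_closure_exp_invariant hcpt μ` (**named fact; Harish-Chandra's
   closure theorem**): for a `(𝔤, K_∞) × GL_n(𝔸_K^∞)`-stable space `W` of `A_G`-invariant cusp
   forms and `X ∈ 𝔤`, the `L²`-closure of the classes of `W` (`l2OfForms W` of
   `AutomorphicRepsGLCuspidalL2Step3`) is invariant under `R(exp X)`. In print: the class of
   `φ ∈ W` is a `K`-finite vector of the sum of finitely many irreducible summands of
   `L²_cusp = ⊕̂_π L²_cusp(π)`, hence a well-behaved (analytic) vector, `𝔤` acting through the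
   Lie derivatives (Getz–Hahn, proof of Thm. 6.5.1 with Cor. 9.1.2; Harish-Chandra 1953,
   Lemma 34; Libine 2012, Thm. 72), and the closure of a `π(𝔅)`-stable space of well-behaved
   vectors is `π(G)`-invariant (Harish-Chandra 1953, Cor. to Thm. 2, p. 211: Hahn–Banach and
   analyticity of `t ↦ ⟪R(exp tX)[φ], u⟫`; Libine Cor. 73). PROVED from it: invariance under all
   of `GL_n(𝔸_K) = K_∞ exp(𝔭) · GL_n(𝔸_K^∞)` (`cuspidal_closure_invariant_of`, by the polar
   decomposition `hasCartanDecomposition_archGroupGL` and the `K_∞`- and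
   `GL_n(𝔸_K^∞)`-stability of `W`), and Step 3a of `AutomorphicRepsGLCuspidalL2Step3`
   (`formsOfL2_closure_exp_invariant_of_cuspidal`: the named fact
   `formsOfL2_closure_exp_invariant hcpt μ` is the case `W ≤ V_Π` of 1., since `V_Π ≤ 𝒜₀`
   consists of `A_G`-invariant functions), so that Step 3 (`formsOfL2_irreducible`) rests on 1.
   and Step 3b (`formsOfL2_irreducible_of_cuspidal`).
2. `AutomorphicRepsGL.cuspidal_closure_irreducible hcpt μ` (**named fact; Harish-Chandra's
   correspondence**): for an IRREDUCIBLE stable `W` as in the target, a closed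
   `GL_n(𝔸_K)`-invariant subspace of `L²` contained in the closure of the classes of `W` is `⊥`
   or contains the classes of `W`. In print: `W` is admissible (it is annihilated by an ideal of
   finite codimension of `Z(𝔤)`; Harish-Chandra's finiteness theorem, Getz–Hahn Thm. 6.1 /
   Borel–Jacquet 4.3 (i)), so the closed invariant subspaces of `Cl[W]` correspond to the
   `(𝔤, K_∞) × GL_n(𝔸_K^∞)`-submodules of `W`, i.e. to `{0, W}` (Harish-Chandra 1953, Thm. 5;
   Libine 2012, Lemma 74 and Cor. 75; density of `K`-finite vectors, Getz–Hahn Prop. 4.4.2 and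
   Lemma 9.8.2).
3. `AutomorphicRepsGL.exists_le_formsOfL2_of_W'_eq_bot_of_HC` (**proved**, the assembly):
   `cuspidal_bounded hcpt`, 1., 2. and the named fact `mem_automorphicForms_iff` of
   `AutomorphicForms` (Borel–Jacquet 4.3: the span of the automorphic forms consists of
   automorphic forms — needed because the generators of `V_Π` are automorphic forms, while `W`
   is only known to lie in the span `𝒜₀` of the cusp forms; its hypotheses hold for the `GL_n`
   datum, `directedOn_finiteLevelsGL`) imply the target: `Π := Cl[W]` is a closed invariant
   subspace (1.) of `L²_cusp` (`l2OfForms_le_cuspidalSubspace`), non-zero (a non-zero `φ ∈ W` is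
   `invQuot f` for a continuous `f ∈ ℒ²`, boundedness, whose class is non-zero since `μ` charges
   open sets) and topologically irreducible (2.), and `W ≤ V_Π` (every `φ ∈ W` is an automorphic
   form `invQuot f` with `[f] ∈ Π`). Hence also `exists_isAssociatedL2 hcpt μ` over the same base
   plus `cuspidal_W'_eq_bot` and `formsOfL2_irreducible` (`exists_isAssociatedL2_of_HC`).

Also proved: `directedOn_finiteLevelsGL` (the levels `{1} × U₀` of the `GL_n` datum are
directed), `isCuspFormGL_of_mem_cuspFormsGL` (elements of `𝒜₀` are cusp forms, from
`mem_automorphicForms_iff`), `toLp_mem_cuspidalSubspace_of_invQuot_mem_cuspFormsGL` and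
`l2OfForms_le_cuspidalSubspace` (classes of square-integrable functions whose inversions lie in
`𝒜₀` lie in `L²_cusp`, by the discharged bridge `cuspConditionGL_invQuot_iff_holds` and the
continuity of automorphic forms), `eq_zero_of_toLp_eq_zero_of_continuous`.

## Design notes

* 1. is stated for every stable `W ≤ 𝒜₀` with `A_G`-invariant elements (not only irreducible
  ones): this is the generality of Harish-Chandra's corollary (no admissibility or irreducibility
  of `W` enters the closure direction) and it makes Step 3a of the sibling decomposition a
  corollary. 2. is stated exactly for the data of the target (`CuspidalAutomorphicRepData` with
  `W' = ⊥`, `A_G`-invariant forms), where admissibility is available in print; its conclusion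
  `l2OfForms W ≤ Q` is, for closed `Q ≤ Cl[W]`, the printed `Q = Cl[W]`.
* Boundedness is consumed in the form `cuspidal_bounded hcpt` (elements of the span `𝒜₀`), the
  form already in the tree; no variant is introduced.
* No definition besides the two named facts; no instance; no `sorry`. (H5) `open scoped
  Classical`.

## References

* J. R. Getz, H. Hahn, *An introduction to automorphic representations, with a view toward trace
  formulae*, GTM 300, Springer (2024) (held; book pages): Thm. 4.4.1, Prop. 4.4.2 (p. 81), Thm. 6.1
  (p. 118), Thm. 6.5.1, Thm. 6.5.2 (p. 121), Cor. 9.1.2 (p. 175), Thm. 9.8.1, Lemma 9.8.2 and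
  the proof of Thm. 6.5.1 (pp. 191–192) [GetzHahn2024].
* Harish-Chandra, *Representations of a semisimple Lie group on a Banach space. I*, Trans. AMS 75
  (1953), 185–243 (held): §7 (well-behaved vectors, p. 209), Thm. 2 and its Corollary
  (pp. 209–211), Lemma 34 and Thm. 5 (pp. 228–229), Thm. 6 (p. 230) [HarishChandraTAMS1953].
* M. Libine, *Introduction to Representations of Real Semisimple Lie Groups* (Schmid's course),
  arXiv:1212.2578 (held): Thm. 72, Cor. 73, Lemma 74, Cor. 75 [Libine2012].
* A. Borel, H. Jacquet, *Automorphic forms and automorphic representations*, Proc. Sympos. Pure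
  Math. 33 (Corvallis 1977), Part 1 (1979), 189–202, §4.3–4.6 [BorelJacquetCorvallis1979]
  (not held; statements cross-checked against the three sources above).
* D. Bump, *Automorphic Forms and Representations* (1997), Thm. 3.3.4, Thm. 3.6.1 (held; the
  spectral route to the same realisation statement, through multiplicity one) [Bump1997].
-/

open scoped MatrixGroups Matrix ContDiff Classical
open NumberField NumberField.mixedEmbedding IsDedekindDomain
open _root_.MeasureTheory

noncomputable section

namespace Literature.NumberTheory.Automorphic

/-! ### 1. Preliminaries on `GL_n`: levels, cusp forms in the span, classes in `L²_cusp` -/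

section Preliminaries

variable {n : ℕ} {K : Type} [Field K] [NumberField K]
  {hcpt : isCompact_glFiniteIntegralLevel n K}

variable (n K) in
/-- The admissible levels of `GL_n` (`finiteLevelsGL`: `{1} × U₀` with `U₀ ≤ GL_n(𝔸_K^∞)` compact
open) are directed downwards: `{1} × (U₀ ∩ V₀)` is again a level below `{1} × U₀` and `{1} × V₀`
(an open subgroup is closed, so `U₀ ∩ V₀` is compact open). Borel–Jacquet 1979, 4.1 (compact open
subgroups form a neighbourhood basis). [cite: BorelJacquetCorvallis1979, 4.1] -/
theorem directedOn_finiteLevelsGL : DirectedOn (· ≥ ·) (finiteLevelsGL n K) := by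
  rintro U ⟨U₀, hU₀o, hU₀c, rfl⟩ V ⟨V₀, hV₀o, hV₀c, rfl⟩
  refine ⟨(U₀ ⊓ V₀).map (GLn.ofFinite n K), ⟨U₀ ⊓ V₀, ?_, ?_, rfl⟩,
    Subgroup.map_mono inf_le_left, Subgroup.map_mono inf_le_right⟩
  · rw [Subgroup.coe_inf]
    exact hU₀o.inter hV₀o
  · rw [Subgroup.coe_inf]
    exact hU₀c.inter_right (V₀.isClosed_of_isOpen hV₀o)

/-- **Elements of the space of cusp forms are cusp forms**, granted the named fact
`mem_automorphicForms_iff` of `AutomorphicForms` (Borel–Jacquet 1979, 4.3: the span of the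
automorphic forms consists of automorphic forms; its hypotheses — directed levels,
finite-dimensional coefficients — hold for the `GL_n` datum): an element of
`cuspFormsGL = span {cusp forms}` is an automorphic form all of whose constant terms vanish (the
cusp conditions are linear, `cuspConditionGL_of_mem_cuspFormsGL`). Borel–Jacquet 1979, 4.3–4.4. [cite: BorelJacquetCorvallis1979, 4.3–4.4] -/
theorem isCuspFormGL_of_mem_cuspFormsGL (hA : mem_automorphicForms_iff (AutomorphyDatum.gl n K hcpt))
    {φ : (AdelicGroupData.gl n K).Adelic → ℂ} (hφ : φ ∈ cuspFormsGL n K hcpt) :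
    IsCuspFormGL n K hcpt φ :=
  ⟨(hA (directedOn_finiteLevelsGL n K) φ).mp (cuspFormsGL_le_automorphicForms n K hcpt hφ),
    fun _ hk hkn ↦ cuspConditionGL_of_mem_cuspFormsGL hφ hk hkn⟩

/-- **A continuous function is determined by its `L²`-class** for a measure charging every
non-empty open set: if `f` is continuous and `[f] = 0` in `L²(μ)`, then `f = 0`
(`Measure.eq_of_ae_eq`). [folklore] -/
theorem eq_zero_of_toLp_eq_zero_of_continuous {X : Type*} [TopologicalSpace X] [MeasurableSpace X]
    {μ : Measure X} [μ.IsOpenPosMeasure] {f : X → ℂ} (hf : MemLp f 2 μ) (hc : Continuous f)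
    (h0 : hf.toLp f = 0) : f = 0 := by
  have hae : f =ᵐ[μ] (0 : X → ℂ) := by
    rw [← MemLp.toLp_eq_toLp_iff hf MemLp.zero, MemLp.toLp_zero]
    exact h0
  exact Measure.eq_of_ae_eq hae hc continuous_zero

variable {μ : Measure (AdelicGroupData.gl n K).automorphicQuotient}
  [(AdelicGroupData.gl n K).IsAutomorphicMeasure μ]

/-- **Classes of square-integrable functions whose inversions lie in `𝒜₀` lie in `L²_cusp`.**
If `f ∈ ℒ²(μ)` and `invQuot f = (g ↦ f [g⁻¹]) ∈ cuspFormsGL n K hcpt` (the span of the cusp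
forms), then `f` is a continuous square-integrable cusp form on the quotient (continuity from
`continuous_of_mem_automorphicForms_gl`, the cusp conditions — linear — through the discharged
bridge `cuspConditionGL_invQuot_iff_holds`), so `[f] ∈ L²_cusp(GL_n(𝔸_K) ⧸ A_G GL_n(K), μ)`
(`mem_cuspidalSubspace_of_isContinuousCuspForm`). Borel–Jacquet 1979, 4.4 and 4.6; Getz–Hahn
2024, §6.5. [cite: BorelJacquetCorvallis1979, 4.4 and 4.6] -/
theorem toLp_mem_cuspidalSubspace_of_invQuot_mem_cuspFormsGL
    {f : (AdelicGroupData.gl n K).automorphicQuotient → ℂ} (hf : MemLp f 2 μ)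
    (hW : invQuot (AdelicGroupData.gl n K) f ∈ cuspFormsGL n K hcpt) :
    hf.toLp f ∈ cuspidalSubspace n K μ := by
  have hcusp : IsContinuousCuspForm n K μ f :=
    ⟨continuous_of_continuous_invQuot
        (continuous_of_mem_automorphicForms_gl (cuspFormsGL_le_automorphicForms n K hcpt hW)),
      hf, fun k hk hkn ↦ (AutomorphicRepsGL.cuspConditionGL_invQuot_iff_holds n K f k).mp
        (cuspConditionGL_of_mem_cuspFormsGL hW hk hkn)⟩
  exact mem_cuspidalSubspace_of_isContinuousCuspForm hcusp

/-- For `W ≤ 𝒜₀`, the classes of `W` lie in `L²_cusp`: `l2OfForms W ≤ L²_cusp`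
(`toLp_mem_cuspidalSubspace_of_invQuot_mem_cuspFormsGL`). Borel–Jacquet 1979, 4.6. [cite: BorelJacquetCorvallis1979, 4.6] -/
theorem l2OfForms_le_cuspidalSubspace {W : Submodule ℂ ((AdelicGroupData.gl n K).Adelic → ℂ)}
    (hW : W ≤ cuspFormsGL n K hcpt) :
    l2OfForms (AdelicGroupData.gl n K) μ W ≤ (cuspidalSubspace n K μ).toSubmodule := by
  rintro x ⟨f, hf, rfl, hfW⟩
  exact toLp_mem_cuspidalSubspace_of_invQuot_mem_cuspFormsGL hf (hW hfW)

end Preliminaries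

/-! ### 2. The two analytic inputs (named facts of Harish-Chandra) -/

section NamedFacts

variable {n : ℕ} {K : Type} [Field K] [NumberField K]
  {hcpt : isCompact_glFiniteIntegralLevel n K}
  {μ : Measure (AdelicGroupData.gl n K).automorphicQuotient}
  [(AdelicGroupData.gl n K).IsAutomorphicMeasure μ]

variable (hcpt μ) in
/-- **Harish-Chandra's closure theorem for spaces of cusp forms on `GL_n`** (the closure
direction of Harish-Chandra's correspondence). Let `W` be a `(𝔤, K_∞) × GL_n(𝔸_K^∞)`-stable
subspace of the space `𝒜₀` of cusp forms on `GL_n(𝔸_K)` (`IsStableSubmodule`,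
`W ≤ cuspFormsGL n K hcpt`) all of whose elements are invariant under `A_G`, and let
`[W] = l2OfForms W ≤ L²(GL_n(𝔸_K) ⧸ A_G GL_n(K), μ)` be the space of classes `[f]`, `f ∈ ℒ²(μ)`,
with `invQuot f ∈ W`. Then for every `X ∈ 𝔤 = 𝔤𝔩_n(K_∞)` the `L²`-closure of `[W]` is invariant
under `R(exp X)`. In print: the elements of `W` are `A_G`-invariant cusp forms (sums of cusp
forms are cusp forms, Borel–Jacquet 1979, 4.3), i.e. elements of `𝒜^{A_G}_cusp ≤ L²_cusp`
(Getz–Hahn 2024, Thm. 9.8.1 and the proof of Thm. 6.5.1, p. 192); there, an element `φ` of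
`𝒜^{A_G}_cusp` is a `K`-finite vector of `L²_cusp = ⊕̂_π L²_cusp(π)` (Cor. 9.1.2, finite
multiplicities) with non-zero components in finitely many `L²_cusp(π)` (it is `Z(𝔤)`-finite of
some level: Harish-Chandra's finiteness theorem, Thm. 6.1), each admissible, the `K`-finite
vectors of `L²_cusp(π)` being exactly `𝒜^{A_G}_cusp ∩ L²_cusp(π)` as a
`(𝔤, K_∞) × G(𝔸^∞)`-module (proof of Thm. 6.5.1; Thm. 4.4.1, Thm. 6.5.2). Hence `[φ]` is a
well-behaved (analytic) vector on which `𝔤` acts through the Lie derivatives, which stay in `W`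
(Harish-Chandra 1953, §7 and Lemma 34; Libine 2012, Thm. 72), and the closure of the
`π(𝔅)`-stable space `[W]` of well-behaved vectors is `π(G)`-invariant: for `u ⊥ [W]` the
analytic function `t ↦ ⟪R(exp tX)[φ], u⟫` vanishes to all orders at `0` (Harish-Chandra 1953,
Cor. to Thm. 2, p. 211; Libine 2012, Cor. 73; Borel–Jacquet 1979, 4.6). No admissibility or
irreducibility of `W` itself is needed for this direction. Not proved here. [cite: HarishChandraTAMS1953, Cor. to Thm. 2 (p. 211) and Lemma 34] -/
def AutomorphicRepsGL.cuspidal_closure_exp_invariant : Prop :=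
  ∀ W : Submodule ℂ ((AdelicGroupData.gl n K).Adelic → ℂ),
    IsStableSubmodule (AutomorphyDatum.gl n K hcpt) W → W ≤ cuspFormsGL n K hcpt →
      (∀ φ ∈ W, ∀ z ∈ (AdelicGroupData.gl n K).center', ∀ g, φ (z * g) = φ g) →
        ∀ (X : (AutomorphyDatum.gl n K hcpt).arch.lie),
          ∀ y ∈ (l2OfForms (AdelicGroupData.gl n K) μ W).topologicalClosure,
            (AdelicGroupData.gl n K).rightRegular μ
                ((AutomorphyDatum.gl n K hcpt).ofArch ((AutomorphyDatum.gl n K hcpt).arch.expMem X)) y ∈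
              (l2OfForms (AdelicGroupData.gl n K) μ W).topologicalClosure

variable (hcpt μ) in
/-- **Harish-Chandra's correspondence for irreducible spaces of cusp forms on `GL_n`** (the
`K`-finite direction). Let `W` be an irreducible `(𝔤, K_∞) × GL_n(𝔸_K^∞)`-stable space of cusp
forms on `GL_n(𝔸_K)` — a cuspidal automorphic representation datum `π = W / ⊥`
(`CuspidalAutomorphicRepData n K hcpt` with `W' = ⊥`) — all of whose elements are invariant under
`A_G`, and let `[W] = l2OfForms W` be the space of its classes in `L²(GL_n(𝔸_K) ⧸ A_G GL_n(K), μ)`.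
Then every closed `GL_n(𝔸_K)`-invariant subspace `Q` of `L²` contained in the closure `Cl[W]` is
`⊥` or contains `[W]` (equivalently, equals `Cl[W]`). In print: `W` is annihilated by an ideal of
finite codimension of `Z(𝔤)` (`Z(𝔤)` commutes with the action and `W` is generated by any
non-zero element), hence admissible by Harish-Chandra's finiteness theorem (Getz–Hahn 2024,
Thm. 6.1, p. 118; Borel–Jacquet 1979, 4.3 (i) and 4.5); the `K_∞ × U`-finite vectors of `Q ≠ 0`
are dense in `Q` (Getz–Hahn Prop. 4.4.2 and Lemma 9.8.2), and a `K`-finite vector of `Cl[W]` of a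
given type lies in the closure of the finite-dimensional space of classes of elements of `W` of
that type, i.e. is the class of an element of `W` (Harish-Chandra 1953, Thm. 5: `Cl(V') ∩ U' = V'`;
Libine 2012, Lemma 74); so `Q` contains the class of some `0 ≠ φ ∈ W`, and with it the classes of
the stable space generated by `φ` (the `L²`-derivative of `t ↦ R(exp tX)[φ]` is `[X φ]` and stays
in the closed invariant `Q`), which is `W` (Harish-Chandra 1953, Thm. 5; Libine 2012, Cor. 75;
Getz–Hahn 2024, Thm. 6.5.2). Not proved here. [cite: HarishChandraTAMS1953, Thm. 5 (pp. 228–229)] -/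
def AutomorphicRepsGL.cuspidal_closure_irreducible : Prop :=
  ∀ π : CuspidalAutomorphicRepData n K hcpt, π.1.W' = ⊥ →
    (∀ φ ∈ π.1.W, ∀ z ∈ (AdelicGroupData.gl n K).center', ∀ g, φ (z * g) = φ g) →
      ∀ Q : ContRepresentation.ClosedSubrep ((AdelicGroupData.gl n K).rightRegular μ),
        Q.toSubmodule ≤ (l2OfForms (AdelicGroupData.gl n K) μ π.1.W).topologicalClosure →
          Q = ⊥ ∨ l2OfForms (AdelicGroupData.gl n K) μ π.1.W ≤ Q.toSubmodule

end NamedFacts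

/-! ### 3. From the one-parameter subgroups to `GL_n(𝔸_K)`-invariance (proved) -/

section Invariance

variable {n : ℕ} {K : Type} [Field K] [NumberField K]
  {hcpt : isCompact_glFiniteIntegralLevel n K}
  {μ : Measure (AdelicGroupData.gl n K).automorphicQuotient}
  [(AdelicGroupData.gl n K).IsAutomorphicMeasure μ]

/-- **The closure of the classes of a stable space of `A_G`-invariant cusp forms is
`G_∞`-invariant**, given `cuspidal_closure_exp_invariant`: `g_∞ = k exp X` by the polar
decomposition `GL_n(K_∞) = K_∞ exp(𝔭)` (`hasCartanDecomposition_archGroupGL`), `R(k)` preserves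
the closure because `W` is `K_∞`-stable (`formsOfL2_closure_ofK_invariant`) and `R(exp X)` by the
named fact. Harish-Chandra 1953, Cor. to Thm. 2; Libine 2012, Cor. 73. [cite: Libine2012, Cor. 73] -/
theorem AutomorphicRepsGL.cuspidal_closure_arch_invariant_of
    (h₂ : AutomorphicRepsGL.cuspidal_closure_exp_invariant hcpt μ)
    {W : Submodule ℂ ((AdelicGroupData.gl n K).Adelic → ℂ)}
    (hW : IsStableSubmodule (AutomorphyDatum.gl n K hcpt) W) (hWc : W ≤ cuspFormsGL n K hcpt)
    (hWA : ∀ φ ∈ W, ∀ z ∈ (AdelicGroupData.gl n K).center', ∀ g, φ (z * g) = φ g)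
    (x : (AutomorphyDatum.gl n K hcpt).arch.carrier) {y : (AdelicGroupData.gl n K).L2 μ}
    (hy : y ∈ (l2OfForms (AdelicGroupData.gl n K) μ W).topologicalClosure) :
    (AdelicGroupData.gl n K).rightRegular μ ((AutomorphyDatum.gl n K hcpt).ofArch x) y ∈
      (l2OfForms (AdelicGroupData.gl n K) μ W).topologicalClosure := by
  obtain ⟨k, hk, X, hX, -, hx⟩ := hasCartanDecomposition_archGroupGL n K x.1 x.2
  have hx' : x = Subgroup.inclusion (AutomorphyDatum.gl n K hcpt).arch.maximalCompact_le_carrier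
      ⟨k, hk⟩ * (AutomorphyDatum.gl n K hcpt).arch.expMem ⟨X, hX⟩ := by
    refine Subtype.ext ?_
    rw [Subgroup.coe_mul, RealMatrixGroup.coe_expMem]
    exact hx
  rw [hx', map_mul, map_mul]
  exact AutomorphicRepsGL.formsOfL2_closure_ofK_invariant hW ⟨k, hk⟩ (h₂ W hW hWc hWA ⟨X, hX⟩ y hy)

/-- **The closure of the classes of a stable space of `A_G`-invariant cusp forms is
`GL_n(𝔸_K)`-invariant**, given `cuspidal_closure_exp_invariant`: `g = (g_∞, 1) · (1, g_f)`
(`GLn.ofInfinite_toMixed_mul_ofFinite_sndHom`), `R(1, g_f)` preserves the classes of the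
`GL_n(𝔸_K^∞)`-stable `W` and hence their closure (`rightRegular_apply_mem_closure_l2OfForms`), and
`R(g_∞, 1)` preserves the closure (`cuspidal_closure_arch_invariant_of`). Harish-Chandra 1953,
Cor. to Thm. 2; Libine 2012, Cor. 73; Borel–Jacquet 1979, 4.6. [cite: Libine2012, Cor. 73] -/
theorem AutomorphicRepsGL.cuspidal_closure_invariant_of
    (h₂ : AutomorphicRepsGL.cuspidal_closure_exp_invariant hcpt μ)
    {W : Submodule ℂ ((AdelicGroupData.gl n K).Adelic → ℂ)}
    (hW : IsStableSubmodule (AutomorphyDatum.gl n K hcpt) W) (hWc : W ≤ cuspFormsGL n K hcpt)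
    (hWA : ∀ φ ∈ W, ∀ z ∈ (AdelicGroupData.gl n K).center', ∀ g, φ (z * g) = φ g)
    (g : (AdelicGroupData.gl n K).Adelic) {y : (AdelicGroupData.gl n K).L2 μ}
    (hy : y ∈ (l2OfForms (AdelicGroupData.gl n K) μ W).topologicalClosure) :
    (AdelicGroupData.gl n K).rightRegular μ g y ∈
      (l2OfForms (AdelicGroupData.gl n K) μ W).topologicalClosure := by
  have hf : GLn.ofFinite n K (GLn.sndHom n K g) ∈ (AutomorphyDatum.gl n K hcpt).finiteAdelic := by
    rw [AutomorphyDatum.gl_finiteAdelic]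
    exact ⟨_, rfl⟩
  have hyf := rightRegular_apply_mem_closure_l2OfForms (hW.finite_stable _ hf) hy
  let x : (AutomorphyDatum.gl n K hcpt).arch.carrier := ⟨GLn.toMixed n K g, Subgroup.mem_top _⟩
  have key : (AdelicGroupData.gl n K).rightRegular μ g =
      (AdelicGroupData.gl n K).rightRegular μ ((AutomorphyDatum.gl n K hcpt).ofArch x) *
        (AdelicGroupData.gl n K).rightRegular μ (GLn.ofFinite n K (GLn.sndHom n K g)) := by
    rw [← map_mul]
    exact congrArg _ (GLn.ofInfinite_toMixed_mul_ofFinite_sndHom g).symm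
  rw [key]
  exact AutomorphicRepsGL.cuspidal_closure_arch_invariant_of h₂ hW hWc hWA x hyf

/-- The elements of `V_Π = formsOfL2 hcpt μ Π` are invariant under `A_G` (each is `invQuot f`,
`exists_toLp_mem_of_mem_formsOfL2`, and `invQuot f` is left `A_G GL_n(K)`-invariant). [folklore] -/
theorem formsOfL2_center'_invariant
    (P : ContRepresentation.ClosedSubrep ((AdelicGroupData.gl n K).rightRegular μ))
    {φ : (AdelicGroupData.gl n K).Adelic → ℂ} (hφ : φ ∈ formsOfL2 hcpt μ P)
    {z : (AdelicGroupData.gl n K).Adelic} (hz : z ∈ (AdelicGroupData.gl n K).center')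
    (g : (AdelicGroupData.gl n K).Adelic) : φ (z * g) = φ g := by
  obtain ⟨f, -, -, rfl, -⟩ := exists_toLp_mem_of_mem_formsOfL2 hφ
  exact invQuot_mul_left _ f ((AdelicGroupData.gl n K).center'_le_quotientSubgroup hz) g

/-- **Step 3a of `AutomorphicRepsGLCuspidalL2Step3` from Harish-Chandra's closure theorem.** The
named fact `formsOfL2_closure_exp_invariant hcpt μ` (closure of the classes of a stable `W ≤ V_Π`
is `R(exp X)`-invariant) is the case `W ≤ V_Π` of `cuspidal_closure_exp_invariant hcpt μ`: such a
`W` consists of cusp forms (`V_Π ≤ 𝒜₀`, `AutomorphicRepsGL.formsOfL2_le_cuspFormsGL`, Step 4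
discharged) invariant under `A_G` (`formsOfL2_center'_invariant`). Harish-Chandra 1953, Cor. to
Thm. 2 and Thm. 5; Libine 2012, Cor. 73. [cite: HarishChandraTAMS1953, Cor. to Thm. 2 (p. 211)] -/
theorem AutomorphicRepsGL.formsOfL2_closure_exp_invariant_of_cuspidal
    (h₂ : AutomorphicRepsGL.cuspidal_closure_exp_invariant hcpt μ) :
    AutomorphicRepsGL.formsOfL2_closure_exp_invariant hcpt μ :=
  fun P _ hWV hW X y hy ↦
    h₂ _ hW (hWV.trans (AutomorphicRepsGL.formsOfL2_le_cuspFormsGL P.le_cuspidalSubspace))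
      (fun _ hφ _ hz g ↦ formsOfL2_center'_invariant P.1 (hWV hφ) hz g) X y hy

/-- Consequently Step 3 (`formsOfL2_irreducible hcpt μ`: irreducibility of the `V_Π`) rests on
`cuspidal_closure_exp_invariant` and Step 3b (`formsOfL2_mem_of_toLp_mem_closure`) alone
(`formsOfL2_irreducible_of`). Harish-Chandra 1953, Thm. 5; Libine 2012, Cor. 75. [cite: Libine2012, Cor. 75] -/
theorem AutomorphicRepsGL.formsOfL2_irreducible_of_cuspidal
    (h₂ : AutomorphicRepsGL.cuspidal_closure_exp_invariant hcpt μ)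
    (h₃b : AutomorphicRepsGL.formsOfL2_mem_of_toLp_mem_closure hcpt μ) :
    AutomorphicRepsGL.formsOfL2_irreducible hcpt μ :=
  AutomorphicRepsGL.formsOfL2_irreducible_of
    (AutomorphicRepsGL.formsOfL2_closure_exp_invariant_of_cuspidal h₂) h₃b

end Invariance

/-! ### 4. The assembly: realisation of irreducible spaces of cusp forms in `L²_cusp` (proved) -/

section Assembly

variable {n : ℕ} {K : Type} [Field K] [NumberField K]
  {hcpt : isCompact_glFiniteIntegralLevel n K}
  {μ : Measure (AdelicGroupData.gl n K).automorphicQuotient}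
  [(AdelicGroupData.gl n K).IsAutomorphicMeasure μ]

/-- **Realisation of irreducible spaces of `A_G`-invariant cusp forms in `L²_cusp`, from the
three analytic inputs** (Borel–Jacquet 1979, 4.6; Getz–Hahn 2024, Thm. 6.5.1–6.5.2;
Harish-Chandra 1953, Thm. 5). Assume `mem_automorphicForms_iff` for the `GL_n` datum
(Borel–Jacquet 4.3), `cuspidal_bounded hcpt` (Getz–Hahn Thm. 9.8.1, sibling file
`AutomorphicRepsGLCuspFormsSquareIntegrable`), `cuspidal_closure_exp_invariant hcpt μ`
(Harish-Chandra's closure theorem) and `cuspidal_closure_irreducible hcpt μ` (Harish-Chandra's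
correspondence). Then `exists_le_formsOfL2_of_W'_eq_bot hcpt μ` holds: given an irreducible
stable `W` of `A_G`-invariant cusp forms, let `Π = Cl[W]` be the `L²`-closure of its classes. It
is a closed `GL_n(𝔸_K)`-invariant subspace (`cuspidal_closure_invariant_of`,
`ClosedSubrep.ofInvariantClosure`) of `L²_cusp` (`l2OfForms_le_cuspidalSubspace`); it is non-zero,
since a non-zero `φ ∈ W` is `invQuot f` with `f` continuous and square-integrable
(`exists_toLp_mem_cuspidalSubspace_of_bounded`) whose class is then non-zero
(`eq_zero_of_toLp_eq_zero_of_continuous`); its closed invariant subspaces are `⊥` or contain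
`[W]`, hence equal `Π` — so `Π` is topologically irreducible
(`ClosedSubrep.isTopIrreducible_toContRep_iff`); and every `φ ∈ W` is an automorphic form
(`isCuspFormGL_of_mem_cuspFormsGL`) of the form `invQuot f` with `[f] ∈ [W] ≤ Π`, i.e.
`φ ∈ V_Π`. [cite: BorelJacquetCorvallis1979, 4.6] -/
theorem AutomorphicRepsGL.exists_le_formsOfL2_of_W'_eq_bot_of_HC
    (hA : mem_automorphicForms_iff (AutomorphyDatum.gl n K hcpt))
    (h₁ : AutomorphicRepsGL.cuspidal_bounded hcpt)
    (h₂ : AutomorphicRepsGL.cuspidal_closure_exp_invariant hcpt μ)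
    (h₃ : AutomorphicRepsGL.cuspidal_closure_irreducible hcpt μ) :
    AutomorphicRepsGL.exists_le_formsOfL2_of_W'_eq_bot hcpt μ := by
  intro π hbot hπ
  -- every element of `W` is `invQuot f` for a continuous square-integrable `f`
  have hrep : ∀ φ ∈ π.1.W, ∃ (f : (AdelicGroupData.gl n K).automorphicQuotient → ℂ)
      (hf : MemLp f 2 μ), Continuous f ∧ invQuot (AdelicGroupData.gl n K) f = φ ∧
        hf.toLp f ∈ cuspidalSubspace n K μ := fun φ hφ ↦
    AutomorphicRepsGL.exists_toLp_mem_cuspidalSubspace_of_bounded (μ := μ) (π.2 hφ) (hπ φ hφ)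
      (h₁ φ (π.2 hφ) (hπ φ hφ))
  -- `Π := Cl[W]`, a closed invariant subspace of `L²`
  let P₀ : ContRepresentation.ClosedSubrep ((AdelicGroupData.gl n K).rightRegular μ) :=
    ContRepresentation.ClosedSubrep.ofInvariantClosure _
      (l2OfForms (AdelicGroupData.gl n K) μ π.1.W)
      fun g _ hy ↦ AutomorphicRepsGL.cuspidal_closure_invariant_of h₂ π.1.stable π.2 hπ g hy
  -- `Π ≤ L²_cusp`
  have hcusp : P₀ ≤ cuspidalSubspace n K μ :=
    ContRepresentation.ClosedSubrep.toSubmodule_le_iff.mp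
      (Submodule.topologicalClosure_minimal _ (l2OfForms_le_cuspidalSubspace π.2)
        (cuspidalSubspace n K μ).isClosed)
  -- `Π ≠ ⊥`
  have hne : P₀ ≠ ⊥ := by
    intro h0
    obtain ⟨φ, hφW, hφ0⟩ :=
      Submodule.exists_mem_ne_zero_of_ne_bot (bot_lt_iff_ne_bot.mp (hbot ▸ π.1.lt))
    obtain ⟨f, hf, hfc, rfl, -⟩ := hrep φ hφW
    have hmem : hf.toLp f ∈ P₀ :=
      (ContRepresentation.ClosedSubrep.mem_ofInvariantClosure_iff _ _).mpr
        (Submodule.le_topologicalClosure _ (toLp_mem_l2OfForms hf hφW))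
    rw [h0, ContRepresentation.ClosedSubrep.mem_bot] at hmem
    have hf0 : f = 0 := eq_zero_of_toLp_eq_zero_of_continuous hf hfc hmem
    exact hφ0 (by rw [hf0]; rfl)
  -- `Π` is topologically irreducible
  have hirr : P₀.toContRep.IsTopIrreducible := by
    rw [ContRepresentation.ClosedSubrep.isTopIrreducible_toContRep_iff]
    refine ⟨hne, fun Q hQ ↦ ?_⟩
    rcases h₃ π hbot hπ Q (ContRepresentation.ClosedSubrep.toSubmodule_le_iff.mpr hQ) with h | h
    · exact Or.inl h
    · exact Or.inr (le_antisymm hQ (ContRepresentation.ClosedSubrep.toSubmodule_le_iff.mp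
        (Submodule.topologicalClosure_minimal _ h Q.isClosed)))
  -- and `W ≤ V_Π`
  refine ⟨⟨P₀, hcusp, hirr⟩, fun φ hφW ↦ ?_⟩
  obtain ⟨f, hf, -, rfl, -⟩ := hrep φ hφW
  refine invQuot_mem_formsOfL2 hf ?_ (isCuspFormGL_of_mem_cuspFormsGL hA (π.2 hφW)).1
  exact (ContRepresentation.ClosedSubrep.mem_ofInvariantClosure_iff _ _).mpr
    (Submodule.le_topologicalClosure _ (toLp_mem_l2OfForms hf hφW))

/-- **`exists_isAssociatedL2` over the Harish-Chandra base.** The named fact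
`AutomorphicRepsGL.exists_isAssociatedL2 hcpt μ` of `AutomorphicRepsGL` (Borel–Jacquet 1979,
4.4–4.6: an `A_G`-invariant cuspidal `π = W / W'` is associated with an irreducible closed
`Π ≤ L²_cusp`) follows from semisimplicity (`cuspidal_W'_eq_bot hcpt`), the four inputs of
`exists_le_formsOfL2_of_W'_eq_bot_of_HC`, and the irreducibility of the `V_Π`
(`formsOfL2_irreducible hcpt μ`), by `exists_isAssociatedL2_of_exists_le_formsOfL2` of
`AutomorphicRepsGLIrreducibleL2`. [cite: BorelJacquetCorvallis1979, 4.4–4.6] -/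
theorem AutomorphicRepsGL.exists_isAssociatedL2_of_HC
    (hss : cuspidal_W'_eq_bot hcpt)
    (hA : mem_automorphicForms_iff (AutomorphyDatum.gl n K hcpt))
    (h₁ : AutomorphicRepsGL.cuspidal_bounded hcpt)
    (h₂ : AutomorphicRepsGL.cuspidal_closure_exp_invariant hcpt μ)
    (h₃ : AutomorphicRepsGL.cuspidal_closure_irreducible hcpt μ)
    (h₄ : AutomorphicRepsGL.formsOfL2_irreducible hcpt μ) :
    AutomorphicRepsGL.exists_isAssociatedL2 hcpt μ :=
  AutomorphicRepsGL.exists_isAssociatedL2_of_exists_le_formsOfL2 hss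
    (AutomorphicRepsGL.exists_le_formsOfL2_of_W'_eq_bot_of_HC hA h₁ h₂ h₃) h₄

end Assembly

end Literature.NumberTheory.Automorphic
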